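import Mathlib
import HarnessLib
import HarnessLib.Audit
import Summits.CriticalPhenomena.Statement
import HarnessLib.Audit.Status.Attr

/-!
Route: IsingEuclidUpgrade

DORMANT since 2026-08-24T21:01:44Z (reconciler: no traction for 7.1 d (last activity statement-claimed at 2026-08-17T18:47:08Z); parked, not closed — `ledger route dormant route-CriticalPhenomena-IsingEuclidUpgrade --off` to reactivate) — unstaffed, not closed; items shared with open routes are served there. `ledger route dormant <id> --off` reactivates.

It suffices to show X_I1′ = (E′) ∧ (U′) (rev 3, repaired statement of the rev-0 thesis (E) ∧ (U)):
(E′) [Euclidean scaling limit, normalised, non-Gaussian] there exist a renormalisation ρ > 0 on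
(0,1], Δ > 0 and continuum
    correlations S on ℝ³ with S n = 0 off NonCoincident such that ρ(δ)^n
⟨σ_{[x1/δ]}⋯σ_{[xn/δ]}⟩_{β_c(3)} → S n locally
    uniformly on non-coincident configurations, S 2 > 0 there, S is translation- and O(3)-invariant,
scale covariant with
    dimension Δ, and U4(S) ≢ 0;
(U′) [inversion upgrade, re-typed] every NORMALISED (S = 0 off NonCoincident), non-degenerate,
Euclidean-invariant,
    scale-covariant pointwise scaling limit S of the critical Ising correlators on ℤ³ is covariant
under the unit
    inversion x ↦ x/|x|² with the same Δ.
(E′) follows from crux r6 (CritIsing3DEuclideanLimit) and crux r4 (U4 ≢ 0 for every non-degenerate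
limit) by
normalising a witness S₀ ↦ S₀·𝟙_{NonCoincident} (translations, O(3) and dilations preserve
injectivity; the lattice
limit, S 2 > 0 and U4 read injective configurations only); (U′) is crux r5′ (= the shared item
InversionUpgradeNormalised). Since IsMoebiusCovariant Δ S := Euclidean ∧ scale ∧ inversion, the
DECIDING THEOREM is
closes : r6 → r4 → r5′ → Ising3DConformalLimit (proved glue, normalisation done inside the proof).
Repair record: the rev-0 thesis (E) ∧ (U) (stmt-0632) and crux r5 = (U) (stmt-0637) let the
covariance predicates
range over ALL configurations while the lattice limit constrains S only on NonCoincident; they are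
refuted as typed
(Theorems/IsingEuclidUpgradeRefutations.lean: not_thesis, not_inversionUpgrade_of_euclideanLimit —
witness: redefine a
Euclidean-limit S₀ on the partially coincident locus) and are dropped (0632) / restated (0637 → r5′;
the vacuous rev-0
Assembly 0633 → `r6 → r4 → r5′ → Ising3DConformalLimit`, the statement `closes` proves) at rev 3.

Lean ((U′); (E′) is the ∃-form with the same normalisation clause and HasNontrivialU4):
∀ (ρ : ℝ → ℝ) (Δ : ℝ) (S : Literature.Probability.LatticeModels.CorrFamily 3), (∀ δ ∈ Set.Ioc (0:ℝ)
1, 0 < ρ δ) → Literature.Probability.LatticeModels.HasPointwiseScalingLimit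
(Literature.Probability.LatticeModels.criticalCorr 3) ρ S → (∀ n z, z ∉
Literature.Probability.LatticeModels.NonCoincident 3 n → S n z = 0) →
Literature.Probability.LatticeModels.IsNondegenerateTwoPoint S →
Literature.Probability.LatticeModels.IsEuclideanInvariant S →
Literature.Probability.LatticeModels.IsScaleCovariant Δ S →
Literature.Probability.LatticeModels.IsInversionCovariant Δ S

Rationale: WHY THIS LINE. Ising3DConformalLimit (=
Literature.Probability.LatticeModels.CritIsing3DConformalLimit) bundles four logically separate
claims: existence of the pointwise scaling limit, Euclidean invariance, scale covariance (one Δ),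
inversion covariance,
plus non-degeneracy/non-Gaussianity. The Literature already isolates the Euclidean half
(CritIsing3DEuclideanLimit,
conformalLimit_implies_euclidean). This route decomposes along that seam: (E′) is a
lattice-probability problem
(random currents, RP/infrared bound: criticalTwoPoint_bounds gives c|x|^{-2} ≤ ⟨σ0σx⟩ ≤ C|x|^{-1},
hence tightness of
ρ-renormalised correlators and Δ ∈ [1/2,1] via scalingDimension_mem_Icc), while (U′) imports
axiomatic QFT: for a
reflection-positive (OS) Euclidean- and scale-invariant theory with a local stress tensor, special
conformal
covariance is expected (Polyakov 1970; Polchinski 1988 in 2D is a theorem; d = 3 open) — ICM2022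
(arXiv:2208.00864)
§8 p.34 recalls exactly this heuristic. Model for the rotation step: DKKMO arXiv:2012.11672 (2D FK,
q ∈ [1,4]).
Non-Gaussianity tool: ADC2021 (arXiv:1912.07973) eq. (3.11), U4 = −2⟨σxσy⟩⟨σzσt⟩·P[double-current
clusters of
{x,y} and {z,t} intersect]; in d = 3 the intersection probability at macroscopic separation is
expected NOT to
vanish (contrast: d ≥ 4 triviality, highDim_triviality / AizenmanDuminilCopinAnnals2021 Thm 1.2).
(U′) is typed over NORMALISED limits (S = 0 off NonCoincident): the rev-0 typing (U) over all S was
refuted through the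
free values of S on the coincident locus (Theorems/IsingEuclidUpgradeRefutations.lean), and the
model-blind version of
(U′) is false at every Δ > 0 (Literature.Barriers.CriticalPhenomena.not_inversionUpgrade_at), so the
lattice clause
HasPointwiseScalingLimit (criticalCorr 3) ρ S and reflection positivity are the load-bearing inputs
by design.
Areas imported: axiomatic/constructive QFT (OS positivity, scale⇒conformal), percolation-type
geometric
representations (random currents). No new objects posited.

RANKED CRUXES.
 r2  IsingEuclidUpgradeR2RotInvPowerLaw — full-space rotation invariance with a pure power law of
the critical
     two-point function on ℤ³: ∃ Δ c>0, ⟨σ0σx⟩_{β_c} · |x|₂^{2Δ} → c as |x| → ∞ (hardest/most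
informative: gives η, Δ,
     ρ(δ)=δ^{-Δ}... and rotation invariance at the 2-point level; ICM2022 lists rotation invariance
on ℤ³ as open).
 r3  IsingEuclidUpgradeR3EtaExists — ∃ η, HasIsingExponentEta 3 η (existence of the anomalous
dimension; weaker than r2).
 r4  IsingEuclidUpgradeR4NonGaussian — every non-degenerate pointwise scaling limit of criticalCorr
3 has U4 ≢ 0
     (non-triviality in d = 3; via the random-current intersection identity). LOAD-BEARING in
`closes`.
 r5′ IsingEuclidUpgradeR5InversionUpgradeR — (U′): inversion covariance of every normalised,
non-degenerate,
     Euclidean-invariant, scale-covariant pointwise scaling limit of criticalCorr 3 (shared item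
     InversionUpgradeNormalised of VolterraWard / HyperoctahedralRP / TauBallRounding /
ModularBoosts /
     HarmonicMomentsIsotropy / PlanarCornerRotations / GaussianScaleMixture). LOAD-BEARING in
`closes`.
 r6  IsingEuclidUpgradeR6EuclideanLimit — CritIsing3DEuclideanLimit (the Literature's Euclidean
statement,
     = (E′) minus normalisation and U4). LOAD-BEARING in `closes`.
 support: IsingEuclidUpgradeNegGaussianLimit (negative side of r4, refutation guard, expected
false).

KILL CRITERIA. Refutation of r4 in the strong form "some non-degenerate limit is Gaussian" (= the
support item
IsingEuclidUpgradeNegGaussianLimit proved) kills the conjunct itself (file ¬conjunct). Refutation of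
r5′ — a normalised
pointwise scaling limit of criticalCorr 3 that is Euclidean invariant and scale covariant but not
inversion covariant —
closes this route AND the seven routes sharing InversionUpgradeNormalised (pivot to IsingCFTData);
note that such a
refutation needs the limit to exist, so in practice it arrives together with r6. Refutation of r2
(e.g. two different
subsequential exponents) kills every route to the conjunct as typed (single Δ). Refutation of r6
kills the conjunct
(conformalLimit_implies_euclidean).

NOT DECOMPOSED YET. Infinite-volume double random currents on ℤ³ (Literature RandomCurrents is
finite-graph only);
the lattice stress tensor / Ward identities / OS reconstruction behind (U′); n-point (n ≥ 3)
tightness beyond Gaussian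
domination for r6; the passage r2 → rotation invariance of all n-point limits. Splits wait for a
crux to close.

CHEAPEST FALSIFIER. For r5′: a lattice test of the inversion Ward identity — Monte-Carlo the
critical 3-D Ising four-point function (Wolff cluster, L = 64→128, β_c = 0.22165463) at pairs of
non-collinear four-point configurations related by the unit inversion about a lattice-remote centre,
rescale by ρ(δ) from the measured two-point function, and compare with the factor ∏‖xᵢ‖^{2Δ}, Δ =
0.5181489 (bootstrap): a mismatch > 5σ that is stable under L → 2L kills (U′) for the Ising limit
(and with it the seven sibling routes sharing InversionUpgradeNormalised). For r2/r3:
axis-versus-diagonal amplitude of ⟨σ0σx⟩|x|^{1+η} (η = 0.036298) in existing high-precision data — a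
splitting stable in L kills r2 as typed. In tree the cheapest check is already run: the barrier
witnesses (ScaleNotMoebius.narrowFamily Δ, witnessFamily) are not scaling limits of criticalCorr 3,
so `not_inversionUpgrade_at` does not instantiate against r5′ (confirmed by reading
Literature/Barriers/CriticalPhenomena/ScaleCovarianceNotMoebius.lean, blocks/evasions).

Novelty: NOVELTY (retriage planner, searched 2026-08-14: `lit search "scale invariance implies conformal
invariance three-dimensional Ising model"` (local+Crossref), `lit search "scale without conformal
invariance unitary virial current dimension"`, `lit search --hybrid` (held books), `lit frontier
CriticalPhenomena --since 2020`, `lit bridges CriticalPhenomena --cross any`, `lit read` of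
arXiv:1501.01776, 1802.02319, 2404.05700, 2208.00864, 2012.11672, 1912.07973, 2309.05797).
Nearest prior art, (U) side [scale => conformal]: Polyakov 1970 prediction (DuminilCopinICM2022 §8.1
p.25); the d=2 Zamolodchikov–Polchinski theorem under unitarity + discrete spectrum (Nakayama2015
§3.1 p.25); d=3 PHYSICS-LEVEL arguments — DelamotteTissierWschebor2016 (arXiv:1501.01776 §5–§6:
sufficient condition "no integrated vector eigen-perturbation of dimension −1", argued for the Ising
class via Lebowitz inequalities under an explicit scaling-limit hypothesis; p.9 "compelling but not
mathematically rigorous" for the general part), MenesesEtAl2019 (arXiv:1802.02319 §1: Monte-Carlo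
bound Δ_V > 5.0 > 2 excludes a virial current, assuming a local conserved stress tensor), De
Polsi–Tissier–Wschebor arXiv:1907.09981 (O(N)); counterexamples to the NAIVE implication:
RivaCardy2005 (elasticity), ElshowkNakayamaRychkov2011 (free Maxwell in d=3, unitary, with stress
tensor); long-range variant without stress tensor: Paulos–Rychkov–van Rees–Zan arXiv:1509.00008. No
rigorous d=3 statement exists (Nakayama2015 p.16; D  [refs: 1501.01776, 1802.02319, 1907.09981, 1509.00008, 2012.11672, DuminilCopinICM2022, Nakayama2015, DelamotteTissierWschebor2016, MenesesEtAl2019, RivaCardy2005, ElshowkNakayamaRychkov2011, ChelkakHonglerIzyurov2015, Sakai2007, DuminilcopinPanis2025, AizenmanDuminilCopinSidoravicius2015, AizenmanCMP1982, AizenmanDuminilCopinAnnals2021]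

Barriers (technique_class: RP scale-to-conformal upgrade + random-currents, d3-specific): BARRIERS (catalogue Literature/Barriers/CriticalPhenomena/; decl names verified with `lean search
--decl`; one line per barrier: applies? / evasion).
Literature.Barriers.CriticalPhenomena.ScaleCovarianceNotMoebius: APPLIES head-on to (U)=r5 (decls
Literature.Barriers.CriticalPhenomena.not_euclideanScaleUpgrade,
not_inversionUpgrade_of_euclidean_data: a Euclidean-invariant, scale-covariant Δ=1/2,
non-degenerate, U4≢0 family need not be inversion covariant, so the model-blind class
EuclideanScaleUpgrade is empty). Evasion: (U) keeps the hypothesis HasPointwiseScalingLimit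
(criticalCorr 3) ρ S — it speaks about Ising limits only — and the intended input is reflection
positivity (Literature.Probability.LatticeModels.isingTorus_reflectionPositive_sites/bonds) +
locality (stress tensor / lattice Ward identities), which the barrier's witness lacks. Honest
status: RP is in tree only on finite tori, there is no OS-reconstruction / stress-tensor
infrastructure; the bet is that RP + a lattice Ward identity survive the limit and exclude a
dimension-2 virial current. Corollary: any proof of (U) must use the Ising hypothesis non-trivially
and (rev-0 refutation) must normalise S off NonCoincident.
Literature.Barriers.CriticalPhenomena.LiouvilleRigidity: applies structurally — in d=3 conformal =
Möbius, so the planar engines behind every proved (E)-type theorem (discrete holomorphicity,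
SLE/CLE, Virasoro; ChelkakHonglerIzyurov2015, arXiv:2012.11672) have no analogue. Not evaded; the
route be

Novelty grade: known — Refuter route-review grade 2026-08-15 (on the route's NOVELTY section + my crossref/local re-check; searchd/openalex/arxiv rate-limited, grounders' page-level sweep of today on 1982/0636/0634 stands). KNOWN as a line: conjunct ↔ (r6 Euclidean scale-covariant limit) ∧ (r4 non-Gaussian) ∧ (r5' scale+E (refuter refuter-rreview1-CriticalPhenomena-IsingEuclidU-c930511b-0, 2026-08-15T18:33:06Z; prior: DuminilCopinICM2022 §8.1 eqs (8.1)-(8.2) p.25, §8.4 p.29 (existence + Kadanoff-Polyakov postulates + Polyakov conformal prediction = r6 + r5'), Polyakov1970, DelamotteTissierWschebor2016 arXiv:1501.01776 §5-§6 (r5' physics-level), MenesesEtAl2019 arXiv:1802.02319 §1, AizenmanDuminilCopinAnnals2021 arXiv:1912.07973 §3 eq.(U4) (r4 handle), ChelkakHonglerIzyurov2015 Thm 1.2 (planar template), Literat)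

History (route lifecycle, newest last):
- 2026-08-15T16:54:30Z · rev 3: restated Assembly (stmt-CriticalPhenomena-0633) — route-repair (rbadge planner, glue): rev-3 SOUNDNESS + GLUE repair. (1) r5 IsingEuclidUpgradeR5InversionUpgrade (stmt-0637; refuted-misstated: R6 → ¬R5, Theorem (planner-rbadge-CriticalPhenomena-IsingEuclidUp-c930511b-g4-0)
- 2026-08-15T16:54:30Z · rev 3: dropped IsingEuclidUpgradeThesis, IsingEuclidUpgradeR5InversionUpgrade — route-repair (rbadge planner, glue): rev-3 SOUNDNESS + GLUE repair. (1) r5 IsingEuclidUpgradeR5InversionUpgrade (stmt-0637; refuted-misstated: R6 → ¬R5, Theorem (planner-rbadge-CriticalPhenomena-IsingEuclidUp-c930511b-g4-0)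
- 2026-08-15T16:59:36Z · rev 4: restated IsingEuclidUpgradeR6EuclideanLimit (stmt-CriticalPhenomena-0638) — route-repair rev 3b (rbadge planner): restate r6 IsingEuclidUpgradeR6EuclideanLimit (stmt-0638) INLINE — same Prop as Literature.Probability.LatticeModels.CritI (planner-rbadge-CriticalPhenomena-IsingEuclidUp-c930511b-g4-0)
- 2026-08-24T21:01:44Z · DORMANT — reconciler: no traction for 7.1 d (last activity statement-claimed at 2026-08-17T18:47:08Z); parked, not closed — `ledger route dormant route-CriticalPhenomena- (operator:999:2755672)

sub-problem: Ising3DConformalLimit · status: dormant · opened planner-CriticalPhenomena-Survey-0 2026-08-13T13:21:19Z · rev 4 · ledger route-CriticalPhenomena-IsingEuclidUpgrade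
GENERATED by the gate from the ledger (D-0016/17). Provers cite these decls: `theorem foo : Summit.CriticalPhenomena.Ising3DConformalLimit.Theses.IsingEuclidUpgrade.<Decl> := …` in Summits/CriticalPhenomena/Ising3DConformalLimit/Theorems/<Name>.lean.
-/

namespace Summit.CriticalPhenomena.Ising3DConformalLimit.Theses.IsingEuclidUpgrade

open scoped BigOperators Topology Manifold Classical MeasureTheory ProbabilityTheory Matrix InnerProductSpace ComplexConjugate ContinuousMap
open Filter Set Function TopologicalSpace MeasureTheory

attribute [summit_statement] _root_.Ising3DConformalLimit

/-! Retired items kept as plain definitions (history; not obligations of this route): landed proofs / closed glue still name them. -/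

/-- retired stmt-CriticalPhenomena-0638 (replaced, gen None) — named by an active item. -/
def IsingEuclidUpgradeR6EuclideanLimit : Prop :=
  Literature.Probability.LatticeModels.CritIsing3DEuclideanLimit

/-- item stmt-CriticalPhenomena-0634 · crux · rank 2 · SPLIT (gen 1) into IsingEuclidUpgradeR2AxisPowerLaw, IsingEuclidUpgradeR2RatioIsotropy + glue IsingEuclidUpgradeR2SplitGlue · direct attempts still welcome (low priority) · by planner
why it might fail: A pure isotropic power law can fail three ways: η need not exist (log⟨σ0σx⟩/log|x| may oscillate inside the rigorous window Δ∈[1/2,1]; η≤1/2 only IF it exists), log corrections, or cubic anisotropy surviving in the amplitude c. The only proofs of such asymptotics are lace expansion (d≫4) and planar.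
sources: DuminilCopinICM2022 §8.1 p.25 (rotation invariance only postulated), Sakai2007 Thm 1.3 (NN d≫4), arXiv:2012.11672 Thm 1.2, Cor 1.6 (planar FK/spin), DuminilcopinPanis2025 Thm 1.5 (d=3: η≤1/2 if it exists), Literature.Probability.LatticeModels.criticalTwoPoint_bounds, Literature.Barriers.CriticalPhenomena.LaceExpansionIsingAboveFour
Crux r2 (hardest, most informative): the critical two-point function of the n.n. Ising model on Z^3
is asymptotically a rotation-invariant pure power law: there are Δ and c>0 with ⟨σ_0 σ_x⟩_{β_c(3)} ·
|x|_2^{2Δ} → c as |x| → ∞ (Euclidean norm, cofinite filter on Z^3). Gives existence of η = 2Δ−1,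
forces ρ(δ) ≍ δ^{-Δ}, and is rotation invariance at the two-point level (open on Z^3: Duminil-Copin
ICM2022 arXiv:2208.00864 §8; 2-D analogue for FK models: DKKMO arXiv:2012.11672). Known input:
c|x|^{-2} ≤ ⟨σ0σx⟩ ≤ C|x|^{-1} (Literature.Probability.LatticeModels.criticalTwoPoint_bounds), so Δ
∈ [1/2,1] if it exists. -/
@[route_item "route-CriticalPhenomena-IsingEuclidUpgrade", crux]
def IsingEuclidUpgradeR2RotInvPowerLaw : Prop :=
  ∃ Δ c : ℝ, 0 < c ∧ Filter.Tendsto (fun x : Literature.Probability.LatticeModels.Site 3 => Literature.Probability.LatticeModels.criticalTwoPoint 3 x * Real.sqrt (∑ i, ((x i : ℝ)) ^ 2) ^ (2 * Δ)) Filter.cofinite (nhds c)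

/-- item stmt-CriticalPhenomena-0635 · crux · rank 3 · open · by planner
why it might fail: log⟨σ0σx⟩/log‖x‖ need not converge at β_c(3): rigorously only liminf/limsup ∈ [−2,−1] (criticalTwoPoint_bounds) and η≤1/2 IF η exists (DCP2025 Thm 1.5); no sub- /super-multiplicativity argument pins a limit AT criticality; existence of η in d=3 is listed as open.
sources: DuminilCopinICM2022 §4.1 p.12, §9 p.30, DuminilcopinPanis2025 Thm 1.5, Literature.Probability.LatticeModels.HasIsingExponentEta, Literature.Probability.LatticeModels.criticalTwoPoint_bounds
Crux r3: the anomalous dimension η of the critical Ising model on Z^3 exists in the logarithmic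
sense of Literature.Probability.LatticeModels.HasIsingExponentEta (log⟨σ0σx⟩_{β_c}/log|x| → −(1+η)).
Strictly weaker than r2; necessary for any single-Δ scaling limit (isingScalingRelationHolds: 2Δ = 1
+ η). Open (ICM2022 §1, §8). -/
@[route_item "route-CriticalPhenomena-IsingEuclidUpgrade"]
def IsingEuclidUpgradeR3EtaExists : Prop :=
  ∃ η : ℝ, Literature.Probability.LatticeModels.HasIsingExponentEta 3 η

/-- item stmt-CriticalPhenomena-0636 · crux · rank 4 · open · by planner
why it might fail: No proof that U4≢0 in d=3: via U4=−2⟨σxσy⟩⟨σzσt⟩·P[double-current clusters of {x,y},{z,t} meet], non-Gaussianity needs that intersection probability to stay >0 at macroscopic separation as δ→0 (currents 'thick', dim>3/2) — unproved for n.n. ℤ³; RP long-range models ON ℤ³ (α<3/2) are Gaussian.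
sources: AizenmanDuminilCopinAnnals2021 §3 eq.(U4) (arXiv p.9), Thm 1.2 (d=4 Gaussian), Panis2023Triviality Thm 1.2, Cor 1.11, §1.1 footnote (d=3 open), DuminilCopinICM2022 §6.4 p.20, Literature.Barriers.CriticalPhenomena.IsingTrivialityFromDimensionFour, Literature.Barriers.CriticalPhenomena.LongRangeTrivialityOnZ3, Literature.Probability.LatticeModels.ursellFour_eq_doubleCurrent
Crux r4 (non-triviality in d=3): every non-degenerate pointwise scaling limit S of the renormalised
critical Ising correlators on Z^3 has connected four-point function U4 ≢ 0 on non-coincident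
configurations. Intended tool: the random-current identity U4(x,y,z,t) =
−2⟨σxσy⟩⟨σzσt⟩·P^{xy,zt}[C_{n1+n2}(x) ∩ C_{n1+n2}(z) ≠ ∅] (Aizenman 1982; ADC2021 arXiv:1912.07973
eq. (3.11)): non-Gaussianity ⇔ the intersection probability of the two double-current clusters at
macroscopic separation does not vanish as δ → 0. Contrast: for d ≥ 4 every such limit IS Gaussian
(Literature.Probability.LatticeModels.highDim_triviality). Its negation refutes the conjunct
Ising3DConformalLimit itself. -/
@[route_item "route-CriticalPhenomena-IsingEuclidUpgrade", crux]
def IsingEuclidUpgradeR4NonGaussian : Prop :=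
  ∀ (ρ : ℝ → ℝ) (S : Literature.Probability.LatticeModels.CorrFamily 3), (∀ δ ∈ Set.Ioc (0:ℝ) 1, 0 < ρ δ) → Literature.Probability.LatticeModels.HasPointwiseScalingLimit (Literature.Probability.LatticeModels.criticalCorr 3) ρ S → Literature.Probability.LatticeModels.IsNondegenerateTwoPoint S → Literature.Probability.LatticeModels.HasNontrivialU4 S

/-- item stmt-CriticalPhenomena-1982 · crux · rank 5 · open · by planner
why it might fail: Model-blind forms are FALSE at every Δ>0 even with normalisation, ℤ₂/permutation symmetry, GKS/Lebowitz shapes (not_inversionUpgrade_at; free Maxwell d=3): a proof must use the Ising lattice clause/RP non-trivially; it dies if the limit has a dimension-2 virial current (excluded only numerically).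
sources: Literature.Barriers.CriticalPhenomena.not_inversionUpgrade_at, Summit.CriticalPhenomena.IsingEuclidUpgrade.not_inversionUpgrade_of_euclideanLimit, ElshowkNakayamaRychkov2011, DelamotteTissierWschebor2016 §5–§6 (arXiv:1501.01776 pp.8–10), MenesesEtAl2019 §1 (arXiv:1802.02319), Nakayama2015 §2.4.3
[crux r5, (D), inversion upgrade re-typed] Every pointwise scaling limit S of criticalCorr 3 (ρ > 0
on (0,1]) that is normalised (S = 0 off NonCoincident), non-degenerate, Euclidean invariant and
scale covariant with Δ is IsInversionCovariant Δ (hence Möbius). This is (U) of route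
IsingEuclidUpgrade (item 0637, refuted AS TYPED by not_inversionUpgrade_of_euclideanLimit through
values on the coincident locus) with the normalisation hypothesis the refutation file prescribes;
the model-blind version is false (Literature.Barriers.CriticalPhenomena.ScaleCovarianceNotMoebius;
free Maxwell d=3, ElshowkNakayamaRychkov2011), so any proof must use the Ising hypothesis (RP +
locality / absence of a dimension-2 virial current: DelamotteTissierWschebor2016 §5–6,
Nakayama2015). -/
@[route_item "route-CriticalPhenomena-IsingEuclidUpgrade", crux]
def IsingEuclidUpgradeR5InversionUpgradeR : Prop :=
  ∀ (ρ : ℝ → ℝ) (Δ : ℝ) (S : Literature.Probability.LatticeModels.CorrFamily 3), (∀ δ ∈ Set.Ioc (0:ℝ) 1, 0 < ρ δ) → Literature.Probability.LatticeModels.HasPointwiseScalingLimit (Literature.Probability.LatticeModels.criticalCorr 3) ρ S → (∀ n z, z ∉ Literature.Probability.LatticeModels.NonCoincident 3 n → S n z = 0) → Literature.Probability.LatticeModels.IsNondegenerateTwoPoint S → Literature.Probability.LatticeModels.IsEuclideanInvariant S → Literature.Probability.LatticeModels.IsScaleCovariant Δ S → Literature.Probability.LatticeModels.IsInversionCovariant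 Δ S

/-- item stmt-CriticalPhenomena-0645 · support · rank 7 · open · by planner
why it might fail: Expected FALSE (d=3 below the upper critical dimension 4); a proof needs BOTH existence of the full pointwise limit and Gaussianity at the 4-point level — no printed evidence for either in d=3.
sources: AizenmanDuminilCopinAnnals2021 Thm 1.2 (d=4 only), DuminilCopinICM2022 §6.4 p.20, §8.4 p.28, Literature.Probability.LatticeModels.highDim_triviality
Negative side of r4 (refutation guard): some non-degenerate pointwise scaling limit of the critical
Ising correlators on Z^3 is Gaussian at the 4-point level (U4 ≡ 0 off the diagonals). Since
pointwise limits along the full filter δ→0+ are unique, this would give ¬Ising3DConformalLimit (the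
conjunct demands HasNontrivialU4). Expected FALSE (d=3 < upper critical dimension 4); staffed low. -/
@[route_item "route-CriticalPhenomena-IsingEuclidUpgrade"]
def IsingEuclidUpgradeNegGaussianLimit : Prop :=
  ∃ (ρ : ℝ → ℝ) (S : Literature.Probability.LatticeModels.CorrFamily 3), (∀ δ ∈ Set.Ioc (0:ℝ) 1, 0 < ρ δ) ∧ Literature.Probability.LatticeModels.HasPointwiseScalingLimit (Literature.Probability.LatticeModels.criticalCorr 3) ρ S ∧ Literature.Probability.LatticeModels.IsNondegenerateTwoPoint S ∧ ¬ Literature.Probability.LatticeModels.HasNontrivialU4 S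

-- earlier Assembly (stmt-CriticalPhenomena-0633, replaced 2026-08-15T16:54:30Z -> stmt-CriticalPhenomena-11251): retired by None — ((∃ (ρ : ℝ → ℝ) (Δ : ℝ) (S : Literature.Probability.LatticeModels.CorrFamily 3), (∀ δ ∈ Set.Ioc (0:ℝ) 1, 0 < ρ δ) ∧ 0 < Δ ∧ Literature.Probability.LatticeModels.HasPointwiseScalingLimit (Literature.Probability.LatticeModels.criticalCorr 3) ρ S ∧ Literature.Probability.La
/-- item stmt-CriticalPhenomena-11251 · assembly · rank 1 · open · by planner
sources: Literature.Probability.LatticeModels.conformalLimit_implies_euclidean, FrancescoMathieuSenechal1997 §4.3.1 eq. (4.62)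
Assembly (rev 3): r6 → r4 → r5′ → Ising3DConformalLimit (root abbrev of
Summits/CriticalPhenomena/Ising3DConformalLimit/Statement =
Literature.Probability.LatticeModels.CritIsing3DConformalLimit). Proof (= the deciding theorem
`closes` of this file, same statement, PROVED): normalise the Euclidean-limit witness of r6, S₀ ↦ S
:= S₀·𝟙_{NonCoincident} (translations, O(3) and dilations preserve injectivity, so S stays Euclidean
invariant and scale covariant; HasPointwiseScalingLimit, IsNondegenerateTwoPoint and HasNontrivialU4
read injective configurations only); r4 gives U4(S) ≢ 0, r5′ gives IsInversionCovariant Δ S, and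
IsMoebiusCovariant Δ S is by definition IsEuclideanInvariant S ∧ IsScaleCovariant Δ S ∧
IsInversionCovariant Δ S (ConformalCovariance.lean). Replaces the rev-0 assembly ((E)∧(U)) →
conjunct, whose antecedent is refuted as typed (not_thesis). -/
@[route_item "route-CriticalPhenomena-IsingEuclidUpgrade"]
def Assembly : Prop :=
  IsingEuclidUpgradeR6EuclideanLimit → IsingEuclidUpgradeR4NonGaussian → IsingEuclidUpgradeR5InversionUpgradeR → Ising3DConformalLimit

-- records of items no longer active in this route (dropped / restated):
-- earlier IsingEuclidUpgradeR6EuclideanLimit (stmt-CriticalPhenomena-0638, replaced 2026-08-15T16:59:36Z -> stmt-CriticalPhenomena-11283): retired by None — Literature.Probability.LatticeModels.CritIsing3DEuclideanLimit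

/-! D-0027 §2.1 — DECIDING THEOREM (planner-authored via `route open/edit --closes-file`; by planner-rbadge-CriticalPhenomena-IsingEuclidUp-c930511b-g4-0 2026-08-15T16:54:30Z):
its hypotheses are this route's items and its conclusion the sub-problem Statement (glue_lint), and it elaborates with this file. -/

@[closes "route-CriticalPhenomena-IsingEuclidUpgrade"] theorem closes (h6 : IsingEuclidUpgradeR6EuclideanLimit) (h4 : IsingEuclidUpgradeR4NonGaussian)
    (h5 : IsingEuclidUpgradeR5InversionUpgradeR) : _root_.Ising3DConformalLimit := by
  classical
  obtain ⟨ρ, Δ, S₀, hρ, hΔ, hlim, hnd, heuc, hsc⟩ := h6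
  -- normalise the Euclidean-limit witness: keep `S₀` on injective configurations, `0` elsewhere
  obtain ⟨S, hS⟩ : ∃ S : Literature.Probability.LatticeModels.CorrFamily 3,
      S = fun n z => if Function.Injective z then S₀ n z else 0 := ⟨_, rfl⟩
  have S_inj : ∀ {n : ℕ} {z : Fin n → EuclideanSpace ℝ (Fin 3)},
      Function.Injective z → S n z = S₀ n z := fun hz => by
    simp only [hS, if_pos hz]
  have S_ninj : ∀ {n : ℕ} {z : Fin n → EuclideanSpace ℝ (Fin 3)},
      ¬ Function.Injective z → S n z = 0 := fun hz => by
    simp only [hS, if_neg hz]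
  have inj_iff : ∀ {n : ℕ} (z : Fin n → EuclideanSpace ℝ (Fin 3))
      {f : EuclideanSpace ℝ (Fin 3) → EuclideanSpace ℝ (Fin 3)}, Function.Injective f →
      (Function.Injective (fun i => f (z i)) ↔ Function.Injective z) := fun z _ hf =>
    hf.of_comp_iff z
  have hnorm : ∀ n z, z ∉ Literature.Probability.LatticeModels.NonCoincident 3 n → S n z = 0 :=
    fun n z hz => S_ninj hz
  have hlim' : Literature.Probability.LatticeModels.HasPointwiseScalingLimit
      (Literature.Probability.LatticeModels.criticalCorr 3) ρ S :=
    fun n => (hlim n).congr_right fun z hz => (S_inj hz).symm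
  have hnd' : Literature.Probability.LatticeModels.IsNondegenerateTwoPoint S := fun z hz => by
    rw [S_inj hz]; exact hnd z hz
  have heuc' : Literature.Probability.LatticeModels.IsEuclideanInvariant S := by
    refine ⟨fun n v z => ?_, fun n R z => ?_⟩
    · by_cases hz : Function.Injective z
      · have hz' : Function.Injective (fun i => z i + v) := (inj_iff z (add_left_injective v)).2 hz
        rw [S_inj hz', S_inj hz]; exact heuc.1 n v z
      · have hz' : ¬ Function.Injective (fun i => z i + v) :=
          fun h => hz ((inj_iff z (add_left_injective v)).1 h)
        rw [S_ninj hz', S_ninj hz]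
    · by_cases hz : Function.Injective z
      · have hz' : Function.Injective (fun i => R (z i)) := (inj_iff z R.injective).2 hz
        rw [S_inj hz', S_inj hz]; exact heuc.2 n R z
      · have hz' : ¬ Function.Injective (fun i => R (z i)) :=
          fun h => hz ((inj_iff z R.injective).1 h)
        rw [S_ninj hz', S_ninj hz]
  have hsc' : Literature.Probability.LatticeModels.IsScaleCovariant Δ S := by
    intro n c hc z
    by_cases hz : Function.Injective z
    · have hz' : Function.Injective (fun i => c • z i) :=
        (inj_iff z (smul_right_injective (EuclideanSpace ℝ (Fin 3)) hc.ne')).2 hz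
      rw [S_inj hz', S_inj hz]; exact hsc n c hc z
    · have hz' : ¬ Function.Injective (fun i => c • z i) :=
        fun h => hz ((inj_iff z (smul_right_injective (EuclideanSpace ℝ (Fin 3)) hc.ne')).1 h)
      rw [S_ninj hz', S_ninj hz, mul_zero]
  have hU4 : Literature.Probability.LatticeModels.HasNontrivialU4 S := h4 ρ S hρ hlim' hnd'
  have hinv : Literature.Probability.LatticeModels.IsInversionCovariant Δ S :=
    h5 ρ Δ S hρ hlim' hnorm hnd' heuc' hsc'
  exact ⟨ρ, Δ, S, hρ, hΔ, hlim', hnd', ⟨heuc', hsc', hinv⟩, hU4⟩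

end Summit.CriticalPhenomena.Ising3DConformalLimit.Theses.IsingEuclidUpgrade
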